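import Mathlib.Analysis.Calculus.ImplicitContDiff
import Mathlib.Analysis.Normed.Module.FiniteDimension
import Mathlib.Topology.Order.IntermediateValue
import HarnessLib

/-!
# Wilkie 1989, §6: two zeros with equal abscissa on a zero set of positive dimension

Trunk `TranscendEllArithS`, family `periods` (periods.S28): a real-analytic input for the leaf
`Literature.ModelTheory.ExponentialFields.Wilkie1989_expAlgebraicPoints_mem` (`Wilkie1989.lean`;
§§5–6 of A. J. Wilkie, *On the theory of the real exponential field*, Illinois J. Math. 33
(1989), 384–408), to be used "by transfer" in the proof of Theorem 2.

In §6 (p. 407) Wilkie argues, for a point `η̄` of the non-singular zero set of fewer equations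
than unknowns: "since `η₁ = d` this implies (by considering a (necessarily continuous)
parametrization of `Vⁿˢ(h₁, …, hₙ₋₁)` close to `η̄` — see Section 2) that for any `ν > 0`, `ν ∈ K`,
there is `η₁' ∈ [d, d + ν)` and distinct points `ζ̄, ζ̄' ∈ Vⁿˢ(h₁, …, hₙ₋₁)` both having first
coordinate `η₁'`. Further, `ζ̄` and `ζ̄'` may be chosen arbitrarily close to `η̄` (for sufficiently
small choice of `ν`)."  The same local parametrization shows, in the cases of p. 406 and of the
points over `k`-rational abscissae (p. 407, "a similar one shows that …"), that such a zero set is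
not isolated at `η̄` inside a hyperplane `x₁ = a`.

We prove the real statement behind both uses (`Real.exists_pair_or_two_sides`): let
`H : E → ℝᵖ` be `C¹` with `H(a) = 0`, surjective derivative at `a` and non-trivial kernel (fewer
independent equations than unknowns), and let `ℓ` be a continuous linear functional (a
coordinate).  Then for every `ε > 0`, either there are two distinct zeros of `H` within `ε` of `a`
with the same value of `ℓ`, or there are zeros of `H` within `ε` of `a` on both sides of the
hyperplane `ℓ = ℓ(a)`.  Proof: the implicit function theorem (Mathlib's `ImplicitFunctionData`,
as in `Real.eventually_eq_of_fderiv_comp_ker` of `Wilkie1989Lemma3.lean`) gives a continuous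
injective path `s ↦ Γ(s v)` in the zero set through `a`; along it `ℓ` either takes values on both
sides of `ℓ(a)` or has an extremum at `a`, and then takes equal values at two distinct parameters
(intermediate value theorem on both sides, `Real.exists_ne_map_eq_of_forall_le`).

## Mathlib search

Mathlib has `ImplicitFunctionData.implicitFunction` with `prodFun_implicitFunction`,
`implicitFunction_apply_image`, `contDiffAt_implicitFunction`, and the intermediate value theorem
(`intermediate_value_Icc`, `intermediate_value_Icc'`); nothing on the local structure of zero
sets of submersions beyond that.

## References

* A. J. Wilkie, *On the theory of the real exponential field*, Illinois J. Math. 33 (1989),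
  384–408: §2 (p. 388, implicit functions), §6 (pp. 406–407).
-/

noncomputable section

open Filter Set Metric Function
open scoped Topology

namespace Literature.ModelTheory.ExponentialFields

namespace Real

variable {E : Type*} [NormedAddCommGroup E] [NormedSpace ℝ E] [CompleteSpace E] {p : ℕ}

/-- A continuous function on `[-s₀, s₀]` with a minimum at `0` takes the same value at two
distinct points (intermediate value theorem on both sides of `0`). [folklore] -/
theorem exists_ne_map_eq_of_forall_le {h : ℝ → ℝ} {s₀ : ℝ} (hs₀ : 0 < s₀)
    (hc : ContinuousOn h (Icc (-s₀) s₀)) (hmin : ∀ s ∈ Icc (-s₀) s₀, h 0 ≤ h s) :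
    ∃ s₁ ∈ Icc (-s₀) s₀, ∃ s₂ ∈ Icc (-s₀) s₀, s₁ ≠ s₂ ∧ h s₁ = h s₂ := by
  set μ := min (h (-s₀)) (h s₀) with hμ_def
  have hμ0 : h 0 ≤ μ :=
    le_min (hmin _ ⟨le_rfl, by linarith⟩) (hmin _ ⟨by linarith, le_rfl⟩)
  obtain ⟨s₁, hs₁, h1⟩ : ∃ s₁ ∈ Icc (-s₀) 0, h s₁ = μ := by
    obtain ⟨s, hs, hsμ⟩ := intermediate_value_Icc' (show -s₀ ≤ 0 by linarith)
      (hc.mono (Icc_subset_Icc le_rfl hs₀.le)) ⟨hμ0, min_le_left _ _⟩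
    exact ⟨s, hs, hsμ⟩
  obtain ⟨s₂, hs₂, h2⟩ : ∃ s₂ ∈ Icc 0 s₀, h s₂ = μ := by
    obtain ⟨s, hs, hsμ⟩ := intermediate_value_Icc (show (0 : ℝ) ≤ s₀ by linarith)
      (hc.mono (Icc_subset_Icc (by linarith) le_rfl)) ⟨hμ0, min_le_right _ _⟩
    exact ⟨s, hs, hsμ⟩
  by_cases hne : s₁ ≠ s₂
  · exact ⟨s₁, ⟨hs₁.1, hs₁.2.trans hs₀.le⟩, s₂, ⟨by linarith [hs₂.1], hs₂.2⟩, hne,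
      h1.trans h2.symm⟩
  · push Not at hne
    have h10 : s₁ = 0 := le_antisymm hs₁.2 (hne ▸ hs₂.1)
    have hμ : h 0 = μ := by rw [← h1, h10]
    rcases min_choice (h (-s₀)) (h s₀) with hm | hm
    · refine ⟨-s₀, ⟨le_rfl, by linarith⟩, 0, ⟨by linarith, hs₀.le⟩, by linarith, ?_⟩
      rw [hμ, hμ_def, hm]
    · refine ⟨0, ⟨by linarith, hs₀.le⟩, s₀, ⟨by linarith, le_rfl⟩, by linarith, ?_⟩
      rw [hμ, hμ_def, hm]

/-- A continuous function on `[-s₀, s₀]` with an extremum at `0`, or else values on both sides of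
`h 0`. [folklore] -/
theorem exists_ne_map_eq_or_two_sides {h : ℝ → ℝ} {s₀ : ℝ} (hs₀ : 0 < s₀)
    (hc : ContinuousOn h (Icc (-s₀) s₀)) :
    (∃ s₁ ∈ Icc (-s₀) s₀, ∃ s₂ ∈ Icc (-s₀) s₀, s₁ ≠ s₂ ∧ h s₁ = h s₂) ∨
      ((∃ s ∈ Icc (-s₀) s₀, h s < h 0) ∧ ∃ s ∈ Icc (-s₀) s₀, h 0 < h s) := by
  by_cases hb : (∃ s ∈ Icc (-s₀) s₀, h s < h 0) ∧ ∃ s ∈ Icc (-s₀) s₀, h 0 < h s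
  · exact Or.inr hb
  · left
    rw [not_and_or] at hb
    push Not at hb
    rcases hb with hmin | hmax
    · exact exists_ne_map_eq_of_forall_le hs₀ hc hmin
    · obtain ⟨s₁, hs₁, s₂, hs₂, hne, heq⟩ :=
        exists_ne_map_eq_of_forall_le (h := fun s => -h s) hs₀ hc.neg
          (fun s hs => neg_le_neg (hmax s hs))
      exact ⟨s₁, hs₁, s₂, hs₂, hne, neg_injective heq⟩

/-- **Two zeros with equal abscissa, or zeros on both sides** (real input for Wilkie 1989, §6,
p. 407, and for the non-isolation of non-singular zero sets of fewer equations than unknowns):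
let `H : E → ℝᵖ` be `C¹` with `H a = 0`, surjective derivative at `a` and non-trivial kernel, and
let `ℓ` be a continuous linear functional.  Then for every `ε > 0`, either there are two distinct
zeros of `H` within `ε` of `a` with the same value of `ℓ`, or there are zeros of `H` within `ε` of
`a` on both sides of the hyperplane `ℓ = ℓ a`. [cite: Wilkie1989, §6, p. 407] -/
theorem exists_pair_or_two_sides (H : E → Fin p → ℝ) (hH : ContDiff ℝ 1 H) (a : E)
    (ha : H a = 0) (hsurj : (fderiv ℝ H a).range = ⊤)
    (hker : ∃ v, v ≠ 0 ∧ fderiv ℝ H a v = 0) (ℓ : E →L[ℝ] ℝ) {ε : ℝ} (hε : 0 < ε) :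
    (∃ x x', H x = 0 ∧ H x' = 0 ∧ dist x a < ε ∧ dist x' a < ε ∧ x ≠ x' ∧ ℓ x = ℓ x') ∨
      ((∃ x, H x = 0 ∧ dist x a < ε ∧ ℓ x < ℓ a) ∧ ∃ x, H x = 0 ∧ dist x a < ε ∧ ℓ a < ℓ x) := by
  set H' : E →L[ℝ] (Fin p → ℝ) := fderiv ℝ H a with hH'
  have hHa : HasStrictFDerivAt H H' a := hH.contDiffAt.hasStrictFDerivAt (by simp)
  have hkerc : H'.ker.ClosedComplemented := H'.ker_closedComplemented_of_finiteDimensional_range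
  set φ : ImplicitFunctionData ℝ E (Fin p → ℝ) H'.ker :=
    HasStrictFDerivAt.implicitFunctionDataOfComplemented H H' hHa hsurj hkerc with hφ
  have hleft : φ.leftFun = H := rfl
  have hpt : φ.pt = a := rfl
  have hright0 : φ.rightFun a = 0 := by simp [φ]
  have hprod : φ.prodFun φ.pt = (0, 0) := by
    rw [ImplicitFunctionData.prodFun_apply, hpt, hleft, ha, hright0]
  set Γ : H'.ker → E := fun z => φ.implicitFunction 0 z with hΓ
  have hΓ0 : Γ 0 = a := by
    have h1 := φ.implicitFunction_apply_image.self_of_nhds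
    rw [hpt, hleft, ha, hright0] at h1
    exact h1
  -- `H ∘ Γ = 0` and `rightFun ∘ Γ = id` near `0`
  have hΓprod : ∀ᶠ z in 𝓝 (0 : H'.ker), φ.prodFun (Γ z) = (0, z) := by
    have h1 := φ.prodFun_implicitFunction
    rw [hprod] at h1
    have hcont : Continuous fun z : H'.ker => ((0 : Fin p → ℝ), z) := by fun_prop
    have h2 := hcont.continuousAt.eventually (show ∀ᶠ q in 𝓝 ((0 : Fin p → ℝ), (0 : H'.ker)),
      φ.prodFun (φ.implicitFunction q.1 q.2) = q from by simpa using h1)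
    filter_upwards [h2] with z hz
    exact hz
  have hHΓ : ∀ᶠ z in 𝓝 (0 : H'.ker), H (Γ z) = 0 := by
    filter_upwards [hΓprod] with z hz
    have := congrArg Prod.fst hz
    simpa [ImplicitFunctionData.prodFun_apply, hleft] using this
  have hRΓ : ∀ᶠ z in 𝓝 (0 : H'.ker), φ.rightFun (Γ z) = z := by
    filter_upwards [hΓprod] with z hz
    have := congrArg Prod.snd hz
    simpa [ImplicitFunctionData.prodFun_apply] using this
  -- `Γ` is continuous near `0`
  have hΓdiff : ∀ᶠ z in 𝓝 (0 : H'.ker), DifferentiableAt ℝ Γ z := by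
    have hc : ContDiffAt ℝ 1 φ.implicitFunction.uncurry (φ.prodFun φ.pt) := by
      refine φ.contDiffAt_implicitFunction ?_ ?_ one_ne_zero
      · rw [hleft]; exact hH.contDiffAt
      · show ContDiffAt ℝ 1 (fun x => Classical.choose hkerc (x - a)) a
        fun_prop
    rw [hprod] at hc
    have h1 := hc.eventually (by simp)
    have hcont : Continuous fun z : H'.ker => ((0 : Fin p → ℝ), z) := by fun_prop
    have h2 := hcont.continuousAt.eventually
      (show ∀ᶠ q in 𝓝 ((0 : Fin p → ℝ), (0 : H'.ker)), ContDiffAt ℝ 1 φ.implicitFunction.uncurry q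
        from by simpa using h1)
    filter_upwards [h2] with z hz
    have hd : DifferentiableAt ℝ φ.implicitFunction.uncurry ((0 : Fin p → ℝ), z) :=
      hz.differentiableAt (by simp)
    exact hd.comp z (by fun_prop)
  have hΓε : ∀ᶠ z in 𝓝 (0 : H'.ker), dist (Γ z) a < ε := by
    have hc : ContinuousAt Γ 0 := (hΓdiff.self_of_nhds).continuousAt
    have : Tendsto Γ (𝓝 0) (𝓝 a) := by rw [← hΓ0]; exact hc
    exact this.eventually (ball_mem_nhds a hε)
  obtain ⟨r₀, hr₀, hball⟩ := Metric.eventually_nhds_iff_ball.1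
    ((hHΓ.and hRΓ).and (hΓdiff.and hΓε))
  -- a non-zero kernel direction and the path `s ↦ Γ (s • v₀)`
  obtain ⟨v, hv0, hv⟩ := hker
  set v₀ : H'.ker := ⟨v, LinearMap.mem_ker.2 hv⟩ with hv₀_def
  have hv₀ : v₀ ≠ 0 := fun h => hv0 (by simpa [hv₀_def] using congrArg Subtype.val h)
  have hnv : 0 < ‖v₀‖ := norm_pos_iff.2 hv₀
  set s₀ : ℝ := r₀ / (2 * ‖v₀‖) with hs₀_def
  have hs₀ : 0 < s₀ := by positivity
  have hmem : ∀ s ∈ Icc (-s₀) s₀, s • v₀ ∈ ball (0 : H'.ker) r₀ := by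
    intro s hs
    rw [mem_ball, dist_zero_right, norm_smul, Real.norm_eq_abs]
    have h1 : |s| ≤ s₀ := abs_le.2 ⟨hs.1, hs.2⟩
    calc |s| * ‖v₀‖ ≤ s₀ * ‖v₀‖ := by gcongr
      _ = r₀ / 2 := by rw [hs₀_def]; field_simp
      _ < r₀ := by linarith
  set γ : ℝ → E := fun s => Γ (s • v₀) with hγ_def
  have hγH : ∀ s ∈ Icc (-s₀) s₀, H (γ s) = 0 := fun s hs => (hball _ (hmem s hs)).1.1
  have hγε : ∀ s ∈ Icc (-s₀) s₀, dist (γ s) a < ε := fun s hs => (hball _ (hmem s hs)).2.2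
  have hγinj : ∀ s ∈ Icc (-s₀) s₀, ∀ s' ∈ Icc (-s₀) s₀, γ s = γ s' → s = s' := by
    intro s hs s' hs' heq
    have h1 := (hball _ (hmem s hs)).1.2
    have h2 := (hball _ (hmem s' hs')).1.2
    have h3 : s • v₀ = s' • v₀ := by rw [← h1, ← h2]; exact congrArg φ.rightFun heq
    exact smul_left_injective ℝ hv₀ h3
  have hγ0 : γ 0 = a := by simp [hγ_def, hΓ0]
  have hγc : ContinuousOn (fun s => ℓ (γ s)) (Icc (-s₀) s₀) := by
    intro s hs
    have h1 : ContinuousAt Γ (s • v₀) := ((hball _ (hmem s hs)).2.1).continuousAt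
    have hsm : Continuous fun s : ℝ => s • v₀ := by fun_prop
    have h2 : ContinuousAt γ s := by
      show ContinuousAt (Γ ∘ fun s : ℝ => s • v₀) s
      exact ContinuousAt.comp (hf := hsm.continuousAt) h1
    exact (ℓ.continuous.continuousAt.comp h2).continuousWithinAt
  -- the dichotomy for `s ↦ ℓ (γ s)` on `[-s₀, s₀]`
  rcases exists_ne_map_eq_or_two_sides hs₀ hγc with ⟨s₁, hs₁, s₂, hs₂, hne, heq⟩ | ⟨⟨s, hs, hlt⟩, ⟨s', hs', hgt⟩⟩
  · left
    refine ⟨γ s₁, γ s₂, hγH s₁ hs₁, hγH s₂ hs₂, hγε s₁ hs₁, hγε s₂ hs₂, fun h => hne ?_, heq⟩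
    exact hγinj s₁ hs₁ s₂ hs₂ h
  · right
    rw [hγ0] at hlt hgt
    exact ⟨⟨γ s, hγH s hs, hγε s hs, hlt⟩, ⟨γ s', hγH s' hs', hγε s' hs', hgt⟩⟩

end Real

end Literature.ModelTheory.ExponentialFields
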